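/-
Copyright (c) 2026. All rights reserved.
Released under Apache 2.0 license as described in the file LICENSE.
Authors: HodgeCM publication cell (pub-hodgecm), GR lane, seat GR-2 (`pub-hodgecm-own-hyp34`).
-/
import Literature.NumberTheory.GelbartRogawski1991.DoubledWeilRepresentationArchHalfGen
import Literature.NumberTheory.GelbartRogawski1991.Prop311AsPrintedOfArchHalf
import HarnessLib

/-!
# [GelbartRogawski1991, Prop. 3.1.1] for every quadratic `E/F` with `E` totally complex (diagonal hermitian data)

The compatible-splitting record `SplittingDatum.CompatibleSplitting` of the general doubling datum
`GRConstructionGen.D` — the tree's form of [GelbartRogawski1991, Proposition 3.1.1] ("`ω_χ` restricted to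
`U(V) × U(W) ⊂ Mp(𝕎)` is an ordinary representation") — for EVERY quadratic extension `E/F` of number fields with `E`
TOTALLY COMPLEX (`F` arbitrary: real and complex places) and diagonal invertible `T_V = diag dV`, `T_W = diag dW`:
**`compatibleSplitting_of_isTotallyComplex`**.  Assembly of the three inputs by GR-2's `compatibleSplitting_of_inputs`
(`CompatibleSplittingQuadraticDoublingGen`): the splitting character `χ` (`exists_isUnitary_isSplittingCharExt_one`),
the finite half (`nonempty_finLocalFamily`, `DoubledWeilRepresentationLocalFamilyGen`) and the archimedean half
(`exists_isArchHalf_gen`, `DoubledWeilRepresentationArchHalfGen`).  The case of `E` with real places (real places of `F`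
split in `E`) is the remaining input of `Prop311AsPrintedOfArchHalf.prop311AsPrinted_of_diagonalArchHalf`.

Topic `NumberTheory/GelbartRogawski1991`; KERNEL only: one theorem; no `def … : Prop`, no named fact, no `sorry`.
Written for the stage-1 cell `pub-hodgecm` (GR lane); nothing here is a claim of the manuscripts adjudicated by that
cell; `HC_CM` is not touched and `Prop311AsPrinted` is not inhabited here.

## References
* S. Gelbart, J. Rogawski, Invent. Math. 105 (1991), §3.1 Proposition 3.1.1 p. 455 L1–3 [GelbartRogawski1991].
* S. S. Kudla, Israel J. Math. 87 (1994), Thm. 3.1 [Kudla1994].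
-/

set_option autoImplicit false

noncomputable section

open scoped Classical
open scoped Matrix
open NumberField NumberField.InfinitePlace IsDedekindDomain
open Literature.NumberTheory.Automorphic Literature.NumberTheory.Automorphic.UnitaryGroup
open Literature.RepresentationTheory.HarrisKudlaSweet1996
open Literature.NumberTheory.GaloisRepresentations

namespace Literature.NumberTheory.GelbartRogawski1991.GRConstructionGen

open UnitaryDualPair

variable (F : Type) [Field F] [NumberField F] (E : Type) [Field E] [NumberField E] [Algebra F E]
  [Algebra.IsQuadraticExtension F E]
variable (c : E ≃ₐ[F] E) {δ : E} (hcδ : c δ = -δ) (hδ : δ ≠ 0) {d : F} (hd : δ * δ = algebraMap F E d)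
variable {N M n : ℕ} (e : Fin N × Fin M ≃ Fin n)
  (dV : Fin N → F) (hV : (Matrix.diagonal dV).IsSymm) (hVd : IsUnit (Matrix.diagonal dV).det) (hdV0 : ∀ i, dV i ≠ 0)
  (dW : Fin M → F) (hW : (Matrix.diagonal dW).IsSymm) (hWd : IsUnit (Matrix.diagonal dW).det) (hdW0 : ∀ j, dW j ≠ 0)

include hdV0 hdW0 in
/-- **[GelbartRogawski1991, Prop. 3.1.1] for `E` totally complex, `F` arbitrary, diagonal data**: the doubling datum
`D` of `(E/F, c, δ, diag dV, diag dW)` carries a compatible splitting (`gru_shape`): the splitting character from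
`exists_isUnitary_isSplittingCharExt_one`, the finite half from `nonempty_finLocalFamily`, the archimedean half from
`exists_isArchHalf_gen`, assembled by `compatibleSplitting_of_inputs`.
[cite: GelbartRogawski1991, §3.1 Proposition 3.1.1 p. 455 L1–3] [cite: Kudla1994, Thm 3.1] -/
theorem compatibleSplitting_of_isTotallyComplex [IsTotallyComplex E] :
    (D F E c hcδ hδ hd e (Matrix.diagonal dV) hV hVd (Matrix.diagonal dW) hW hWd).CompatibleSplitting := by
  -- `have` before `obtain` (the datum's telescope is large)
  have hχex := exists_isUnitary_isSplittingCharExt_one F E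
  obtain ⟨χ, hχu, hχ⟩ := hχex
  exact compatibleSplitting_of_inputs F E c hcδ hδ hd e (Matrix.diagonal dV) hV hVd (Matrix.diagonal dW) hW hWd χ
    (fun 𝔪 => nonempty_finLocalFamily F E c hcδ hδ hd e (Matrix.diagonal dV) hV hVd (Matrix.diagonal dW) hW hWd χ hχ 𝔪)
    (exists_isArchHalf_gen F E c hcδ hδ hd e dV hV hVd hdV0 dW hW hWd hdW0 χ hχu hχ)

/-! ### Build-lane note (ops-buildfix G11b-3 recipe, LEDGER B13-1, 2026-08-21)
As in `CompatibleSplittingQuadraticDoublingGen`: tagged `[implicit_reducible]` purely to keep the large statement out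
of the library-suggestion premise index of the hub build lane; no statement or proof is changed. -/
set_option allowUnsafeReducibility true in
attribute [implicit_reducible] compatibleSplitting_of_isTotallyComplex

end Literature.NumberTheory.GelbartRogawski1991.GRConstructionGen

end
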